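import Literature.MathematicalPhysics.QuantumLattice.PairFieldCommutatorLocality
import Literature.MathematicalPhysics.QuantumLattice.HubbardNNNHoppingLocalHamiltonian
import Literature.MathematicalPhysics.QuantumLattice.HubbardNNNHoppingWindowCertificate
import HarnessLib

/-!
# Locality of the double commutator `[O, [H^{tt'}_L, O]]`, `O = Δ_g + Δ_g†`, for the `t–t'` Hubbard torus

Topic `Literature/MathematicalPhysics/QuantumLattice`; `t–t'` twin of the `t' = 0` statement
`exists_norm_expect_doubleCommutator_pairField_le` of `PairFieldCommutatorLocality.lean`. Everything is
PROVED; no named fact, no definition, no `sorry`.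

* `hubbardTorusTT'_commutator_sum_relabel_translate` — the commutator of `H^{tt'}_L = hubbardTorusTT' L t t' U`
  with a translation sum `Σ_v T_v Γ A` of an embedded local observable is the translation sum of the embedded
  LOCAL commutator `[H^{tt'}_{Λ'}, Γ(incl) A]` (`Λ' ⊇ thicken Λ 1`; translation invariance of `H^{tt'}_L` and
  `hubbardTorusTT'_commutator_fermionEmbed` term by term) — `t–t'` twin of
  `hubbardTorus_commutator_sum_relabel_translate`.
* **`exists_norm_expect_doubleCommutator_pairField_le_TT'`** — `‖⟨ψ, [O, [H^{tt'}_L, O]] ψ⟩‖ ≤ C·L²`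
  uniformly in the unit vector `ψ` and the side `L ≥ L₀`: the `O(L²)` constant of the Horsch–von der Linden
  double-commutator identity (Koma–Tasaki 1994, Theorem 2.2) for the `t–t'` model, again WITHOUT the
  commuting-densities hypothesis (bond pairs sharing a site do not commute).

References: T. Koma, H. Tasaki, J. Stat. Phys. 76 (1994) 745, Theorem 2.2 (2.9) [KomaTasaki1994];
O. Bratteli, D. W. Robinson, *Operator Algebras and Quantum Statistical Mechanics 2* (1997), §6.2.1 and
Thm. 6.2.4 [BratteliRobinsonII1997]; H. Xu et al., Science 384 (2024) eadh7691, eq. (1) [XuEtAl2024].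
-/

noncomputable section

namespace Literature.MathematicalPhysics.QuantumLattice

open Matrix Finset HubbardWave0 Literature.Probability.LatticeModels
open scoped ComplexOrder BigOperators

/-! ### `[H^{tt'}_L, Σ_v T_v Γ A]` is a translation sum -/

/-- **The commutator of the `t–t'` torus Hamiltonian with a translation sum** of an embedded local
observable is the translation sum of the embedded LOCAL commutator: for `A ∈ 𝔄_Λ`, `Λ' ⊇ thicken Λ 1`,
and `x ↦ x mod L` injective on `thicken Λ' 1`,
`H^{tt'}_L (Σ_v T_v Γ A) − (Σ_v T_v Γ A) H^{tt'}_L = Σ_v T_v Γ_{Λ'}(H^{tt'}_{Λ'} A − A H^{tt'}_{Λ'})`.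
[cite: BratteliRobinsonII1997, Thm. 6.2.4] [cite: XuEtAl2024, eq. (1)] -/
theorem hubbardTorusTT'_commutator_sum_relabel_translate (L : ℕ) [NeZero L] (t t' U : ℝ)
    {Λ Λ' : Finset (Site 2)} (hΛ : Λ ⊆ Λ') (h8 : thicken Λ 1 ⊆ Λ')
    (hInj : Set.InjOn (Torus.proj (d := 2) L) ↑(thicken Λ' 1)) (A : FermionOp Λ) :
    hubbardTorusTT' L t t' U *
          (∑ v : TorusSite 2 L, relabel (Orb.translate v)
            (fermionEmbed (PolySite.toTorusEmb L (hInj.mono (by exact_mod_cast subset_thicken Λ' 1)))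
              (fermionEmbed (PolySite.incl hΛ) A))) -
        (∑ v : TorusSite 2 L, relabel (Orb.translate v)
            (fermionEmbed (PolySite.toTorusEmb L (hInj.mono (by exact_mod_cast subset_thicken Λ' 1)))
              (fermionEmbed (PolySite.incl hΛ) A))) * hubbardTorusTT' L t t' U =
      ∑ v : TorusSite 2 L, relabel (Orb.translate v)
        (fermionEmbed (PolySite.toTorusEmb L (hInj.mono (by exact_mod_cast subset_thicken Λ' 1)))
          ((hubbardTTPrimeFermionInteraction t t' U).localHamiltonian Λ' * fermionEmbed (PolySite.incl hΛ) A -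
            fermionEmbed (PolySite.incl hΛ) A * (hubbardTTPrimeFermionInteraction t t' U).localHamiltonian Λ')) := by
  rw [Finset.mul_sum, Finset.sum_mul, ← Finset.sum_sub_distrib]
  refine Finset.sum_congr rfl fun v _ => ?_
  rw [← hubbardTorusTT'_commutator_fermionEmbed L t t' U hΛ h8 hInj A, relabel_sub, relabel_mul, relabel_mul,
    relabel_translate_hubbardTorusTT']

/-! ### Locality of the double commutator `[O, [H^{tt'}_L, O]]`, `O = Δ_g + Δ_g†` -/

/-- **`‖⟨ψ, [O, [H^{tt'}_L, O]] ψ⟩‖ ≤ C·L²` for `O = Δ_g + Δ_g†` and the `t–t'` Hubbard torus Hamiltonian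
`H^{tt'}_L = hubbardTorusTT' L t t' U`, uniformly in the unit vector `ψ` and the side `L ≥ L₀`.** `O` is the
translation sum of the even local observable `A + Aᴴ` (`A` the local pair at the origin); `[H^{tt'}_L, O]` is
the translation sum of the embedded local commutator `[H^{tt'}_{Λ'}, A + Aᴴ]`, `Λ' = thicken (pairRegion) 1`
(`hubbardTorusTT'_commutator_sum_relabel_translate`); the commutator of the two translation sums is the
translation sum of a local density (`expect_commutator_sum_relabel_translate`). The `O(L²)` constant of
Koma–Tasaki 1994 Theorem 2.2 (`‖[[O,H],O]‖ ≤ 4r²ho²N`) for the `t–t'` model, WITHOUT the hypothesis that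
the order-operator densities commute at different sites. [cite: KomaTasaki1994, Theorem 2.2 (2.9)]
[cite: BratteliRobinsonII1997, §6.2.1] -/
theorem exists_norm_expect_doubleCommutator_pairField_le_TT' (g : Site 2 → ℝ) (t t' U : ℝ) :
    ∃ C : ℝ, ∃ L₀ : ℕ, 0 ≤ C ∧ ∀ (L : ℕ) [NeZero L], L₀ ≤ L →
      ∀ ψ : Fock (Orb (FermionTorus 2 L)), star ψ ⬝ᵥ ψ = 1 →
        ‖expect ((pairField g L + (pairField g L)ᴴ) *
              (hubbardTorusTT' L t t' U * (pairField g L + (pairField g L)ᴴ) -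
                (pairField g L + (pairField g L)ᴴ) * hubbardTorusTT' L t t' U) -
            (hubbardTorusTT' L t t' U * (pairField g L + (pairField g L)ᴴ) -
                (pairField g L + (pairField g L)ᴴ) * hubbardTorusTT' L t t' U) *
              (pairField g L + (pairField g L)ᴴ)) ψ‖ ≤ C * (L : ℝ) ^ 2 := by
  -- regions and local data
  set S : Finset (Site 2) := insert (0 : Site 2) unitSteps with hS
  set ΛA : Finset (Site 2) := pairRegion S 0 with hΛA
  set A : FermionOp ΛA := localPairAt S g 0 with hAdef
  set Oloc : FermionOp ΛA := A + Aᴴ with hOloc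
  have hOeven : Oloc ∈ carEvenSubalgebra (Finset.univ : Finset (Orb (PolySite ΛA))) :=
    add_mem (localPairAt_mem_carEvenSubalgebra S g 0) (localPairAt_conjTranspose_mem_carEvenSubalgebra S g 0)
  set Λ' : Finset (Site 2) := thicken ΛA 1 with hΛ'
  have hAΛ' : ΛA ⊆ Λ' := subset_thicken ΛA 1
  have h8 : thicken ΛA 1 ⊆ Λ' := subset_of_eq rfl
  set Cloc : FermionOp Λ' := (hubbardTTPrimeFermionInteraction t t' U).localHamiltonian Λ' *
      fermionEmbed (PolySite.incl hAΛ') Oloc -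
    fermionEmbed (PolySite.incl hAΛ') Oloc * (hubbardTTPrimeFermionInteraction t t' U).localHamiltonian Λ' with hCloc
  set Z : Finset (Site 2) := (Λ' ×ˢ ΛA).image (fun p => p.1 - p.2) with hZ
  set Ω : Finset (Site 2) := (ΛA ∪ Λ') ∪ Z.biUnion (fun z => shiftSet z ΛA) with hΩ
  have hA : ΛA ⊆ Ω := Finset.subset_union_left.trans Finset.subset_union_left
  have hC : Λ' ⊆ Ω := Finset.subset_union_right.trans Finset.subset_union_left
  have hZΩ : ∀ z ∈ Z, shiftSet z ΛA ⊆ Ω := fun z hz =>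
    (Finset.subset_biUnion_of_mem (fun z => shiftSet z ΛA) hz).trans Finset.subset_union_right
  have hcomplete : ∀ a ∈ ΛA, ∀ c ∈ Λ', c - a ∈ Z := fun a ha c hc =>
    Finset.mem_image.2 ⟨(c, a), Finset.mem_product.2 ⟨hc, ha⟩, rfl⟩
  set D : FermionOp Ω := commDensity Ω Z hC Oloc Cloc with hDdef
  -- thresholds
  obtain ⟨L₁, hL₁⟩ := exists_forall_le_injOn_proj Ω
  obtain ⟨L₂, hL₂⟩ := exists_forall_le_injOn_proj Z
  obtain ⟨L₃, hL₃⟩ := exists_forall_le_injOn_proj (thicken Λ' 1)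
  refine ⟨∑ s, ∑ t, ‖D s t‖, max (max L₁ L₂) L₃,
    Finset.sum_nonneg fun s _ => Finset.sum_nonneg fun t _ => norm_nonneg _, fun L _ hL ψ hψ => ?_⟩
  have hΩinj : Set.InjOn (Torus.proj (d := 2) L) ↑Ω :=
    hL₁ L (le_trans (le_trans (le_max_left _ _) (le_max_left _ _)) hL)
  have hZinj : Set.InjOn (Torus.proj (d := 2) L) ↑Z :=
    hL₂ L (le_trans (le_trans (le_max_right _ _) (le_max_left _ _)) hL)
  have hTinj : Set.InjOn (Torus.proj (d := 2) L) ↑(thicken Λ' 1) := hL₃ L (le_trans (le_max_right _ _) hL)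
  -- `O` as a translation sum of `Γ_{ΛA} Oloc`, written with the embedding proofs of the two lemmas
  have hO1 : pairField g L + (pairField g L)ᴴ = ∑ v : TorusSite 2 L, relabel (Orb.translate v)
      (fermionEmbed (PolySite.toTorusEmb L (hΩinj.mono (Finset.coe_subset.2 hA))) Oloc) := by
    rw [pairField_conjTranspose_eq_sum_relabel_translate g L (hΩinj.mono (Finset.coe_subset.2 hA)),
      pairField_eq_sum_relabel_translate g L (hΩinj.mono (Finset.coe_subset.2 hA)),
      ← Finset.sum_add_distrib]
    refine Finset.sum_congr rfl fun v _ => ?_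
    rw [← relabel_add, ← fermionEmbed_add]
  have hO2 : pairField g L + (pairField g L)ᴴ = ∑ v : TorusSite 2 L, relabel (Orb.translate v)
      (fermionEmbed (PolySite.toTorusEmb L (hTinj.mono (by exact_mod_cast subset_thicken Λ' 1)))
        (fermionEmbed (PolySite.incl hAΛ') Oloc)) := by
    rw [hO1]
    refine Finset.sum_congr rfl fun v _ => ?_
    rw [fermionEmbed_toTorusEmb_incl]
  -- `[H^{tt'}, O]` as a translation sum of `Γ_{Λ'} Cloc`
  have hHO : hubbardTorusTT' L t t' U * (pairField g L + (pairField g L)ᴴ) -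
      (pairField g L + (pairField g L)ᴴ) * hubbardTorusTT' L t t' U =
      ∑ w : TorusSite 2 L, relabel (Orb.translate w)
        (fermionEmbed (PolySite.toTorusEmb L (hΩinj.mono (Finset.coe_subset.2 hC))) Cloc) := by
    rw [hO2, hubbardTorusTT'_commutator_sum_relabel_translate L t t' U hAΛ' h8 hTinj Oloc]
  have key := expect_commutator_sum_relabel_translate L hΩinj hZinj hA hC hZΩ hcomplete hOeven Cloc ψ
  rw [← hO1, ← hHO] at key
  rw [key, norm_mul, norm_pow, Complex.norm_natCast, mul_comm]
  exact mul_le_mul_of_nonneg_right (norm_torusAvgExpectAt_le_sum_norm L Ω D hψ) (by positivity)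

end Literature.MathematicalPhysics.QuantumLattice

end
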